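/- Fleet seat `ym-wcr-19608-p2` (g2), route `WeakCouplingRates`, crux `BulkDominatesColdBoxW` (stmt-QuantumFields-19609), line `dlr-chessboard` (v8):
the registered stub `stub_kernelMeanExpansion` BY NAME — exponent bookkeeping of the instantiated mean core. -/
import Summits.QuantumFields.YangMills.Theorems.WeakCouplingRatesBulkDominatesColdBoxWKernelMeanTrunk
import Summits.QuantumFields.YangMills.Theorems.WeakCouplingRatesBulkDominatesColdBoxWKernelMeanPrelims
import Summits.QuantumFields.YangMills.Theorems.WeakCouplingRatesBulkDominatesColdBoxWDatumPackage
import Summits.QuantumFields.YangMills.Theorems.WeakCouplingRatesBulkDominatesColdBoxWKernelBridge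
import Summits.QuantumFields.YangMills.Theorems.WeakCouplingRatesBulkDominatesColdBoxWShiftSmall
import Summits.QuantumFields.YangMills.Theorems.WeakCouplingRatesBulkDominatesColdBoxWDirKernelTwoPoint

/-!
# Crux `BulkDominatesColdBoxW`: the registered stub `stub_kernelMeanExpansion` (interface N2, mean form) — PROVED

`stub_kernelMeanExpansion : ∃ θ₂ > 0, ∀ 0 < θ ≤ θ₂, KernelMeanExpansion θ (θ/5)` with `θ₂ = 1/100`.  For `β ≥ β₀(θ)` and a crude-good datum `ω`
(scale `β^{2δ−1}`, `δ = θ/5`, box `H = ⌈β^θ⌉`), the datum package (`exists_datum_package_eventually`, lead `ym-wcr-19609-p1` g2) provides a gauge `g`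
and a zero-extended exterior chart datum `ϑ` (radius `r² = 2·278400²β^{6θ+2δ−1}`, zero on the forest) with the interface's energy clause; the kernel
`γ(·|ω)` has the same plaquette means as `γ(·|W)`, `W = forestFix (glueWith E (ω^g) 1)` (bridge `integral_plaqCostAt_boxKernel_eq_trunc_gauge_of_near_centre`
+ `integral_boxKernel_forestFix_eq`) and the same large-field mass (`measureReal_largeField_boxKernel_eq_of_gauge_trunc`, `boxKernel_real_coldGoodSet_compl_le`
with `ε = 4θ`); the deterministic instantiated core `abs_kernelMean_sub_le_of_trunk` (this seat, `…KernelMeanTrunk`) at `W` with the link bound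
`m = 10⁸(2H+3)²β^{4θ−1/2}`, the Gaussian radius `R = β^ε/2`, the background bound `R' = β^ε/4` (`dirBackground_shift_small_eventually` on touching
plaquettes; `4√(2β)r` on the others) and `pY = e^{−β^ε}` then bounds `|β·E_ω c_x − (3/2)V_D(x) − βΣ_c F̄_c(x)²|` by
`8βe^{−β^ε} + β^{2ε}(e^{2w}−1) + 362βm³ + 2(1 + 6Σ_c(F_c⁴ + 3V_D²))√p`, every term of which is `≤ ¼β^{−θ}` eventually for `θ ≤ 1/100`
(`…EventuallyPow`; binding exponent `31θ < ½`).  No sorry; no new definition; standard axioms.  NOT a claim about the mass gap.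
-/

set_option autoImplicit false

noncomputable section

open MeasureTheory Finset Filter
open Literature.Probability.LatticeModels (Site glueWith glueWith_apply_mem glueWith_apply_not_mem)
open Literature.MathematicalPhysics.QuantumLattice
open Literature.MathematicalPhysics.QuantumFieldTheory
open Literature.MathematicalPhysics.QuantumFieldTheory.LatticeMaxwell
open Literature.MathematicalPhysics.QuantumFieldTheory.AxialGauge

namespace Summit.QuantumFields.YangMills.Theorems.WeakCouplingRates

/-! ## The stub -/

set_option maxHeartbeats 1600000 in
/-- **Registered stub `stub_kernelMeanExpansion` of crux `BulkDominatesColdBoxW` (skeleton v8 `467507eaefe7a2cc`), BY NAME**, with `θ₂ = 1/100`.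
See the module docstring for the chain.  (One long assembly proof: the heartbeat budget is raised for this declaration only.) -/
theorem stub_kernelMeanExpansion : ∃ θ₂ : ℝ, 0 < θ₂ ∧ ∀ θ : ℝ, 0 < θ → θ ≤ θ₂ → KernelMeanExpansion θ (θ / 5) := by
  refine ⟨1 / 100, by norm_num, fun θ hθ hθ₂ => ?_⟩
  -- parameters: δ = θ/5, ε = 4θ
  have hδ0 : (0 : ℝ) ≤ θ / 5 := by positivity
  have hε0 : (0 : ℝ) < 4 * θ := by positivity
  have h7θ : (0 : ℝ) < 7 * θ := by positivity
  -- structural inputs, eventually in β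
  obtain ⟨β₁, hpack⟩ := exists_datum_package_eventually (δ := θ / 5) hθ hδ0 (by linarith)
  obtain ⟨β₂, hrare⟩ := boxKernel_real_coldGoodSet_compl_le (δ := θ / 5) (ε := 4 * θ) hθ hδ0 (by linarith)
  obtain ⟨β₃, hshift⟩ := dirBackground_shift_small_eventually (δ := θ / 5) (ε := 4 * θ) hθ (by linarith)
  -- numeric inputs, eventually in β (constants: Cm = 10⁸)
  obtain ⟨b, hb1', hnum⟩ := kernelMean_eventually hθ hθ₂
  -- the threshold
  unfold KernelMeanExpansion
  refine ⟨max (max β₁ β₂) (max β₃ b), fun β hβ ω hω => ?_⟩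
  simp only [max_le_iff] at hβ
  obtain ⟨⟨hb1, hb2⟩, hb3, hc⟩ := hβ
  have hβ1 : (1 : ℝ) ≤ β := hb1'.trans hc
  have hβ0 : 0 < β := by linarith
  have sqrt_two_le_two : Real.sqrt 2 ≤ 2 := by
    have h : Real.sqrt 2 ≤ Real.sqrt 4 := Real.sqrt_le_sqrt (by norm_num)
    rwa [show (4 : ℝ) = 2 ^ 2 by norm_num, Real.sqrt_sq (by norm_num)] at h
  -- instantiate everything at this β, THEN name the box
  obtain ⟨g, ϑ, hW, hϑ, hforest, s, hE⟩ := hpack β hb1 ω hω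
  have hrareβ := hrare β hb2 ω hω
  have hshiftβ := hshift β hb3 ϑ s hE
  obtain ⟨E1β, E2β, E3β, E4β, E5β, E6β, E7β, E8β, E9β, E10β, E11β, E12β⟩ := hnum β hc
  obtain ⟨hA2, hA4, hAhalf, h8θ, h12θ, h20θ, h16θ, h18θ, hεeq, hsqrtε, hDsq, hA2split⟩ := kernelMean_rpow_dictionary hβ0 θ
  obtain ⟨hreq, hsr, hrle, hr2eq⟩ := kernelMean_radius hβ0 hβ1 hθ
  obtain ⟨hH1r, hH2r⟩ := one_le_ceil_rpow_and_le hβ1 hθ.le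
  have hH : 1 ≤ ⌈β ^ θ⌉₊ := by exact_mod_cast hH1r
  set S : ℝ := 2 * (⌈β ^ θ⌉₊ : ℝ) + 3 with hSdef
  have hHn0 : (0 : ℝ) ≤ (⌈β ^ θ⌉₊ : ℝ) := Nat.cast_nonneg _
  have hS1 : (1 : ℝ) ≤ S := by rw [hSdef]; linarith only [hH1r]
  have hS0 : 0 < S := by linarith only [hS1]
  have h2H1 : 2 * (⌈β ^ θ⌉₊ : ℝ) + 1 ≤ S := by rw [hSdef]; linarith only [hHn0]
  have h4S : (2 * (⌈β ^ θ⌉₊ : ℝ) + 1) ^ 4 ≤ S ^ 4 := pow_le_pow_left₀ (by positivity) h2H1 4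
  have hL : 12 * (⌈β ^ θ⌉₊ : ℝ) ^ 2 + 2 * ⌈β ^ θ⌉₊ + 1 ≤ 3 * S ^ 2 := by rw [hSdef]; nlinarith only [hHn0]
  -- the truncated gauge copy
  set W : LGConfig 4 (Matrix.specialUnitaryGroup (Fin 2) ℂ) := forestFix ⌈β ^ θ⌉₊ (glueWith (boxEdgesAt dirCorner (2 * ⌈β ^ θ⌉₊ + 3))
    (fun e' : ↥(boxEdgesAt dirCorner (2 * ⌈β ^ θ⌉₊ + 3)) => gaugeTransformZd g ω e'.1) (fun _ => 1)) with hWdef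
  refine ⟨ϑ, s, hE, fun x hx => ?_⟩
  -- the rpow dictionary: A = β^{4θ}, D = β^{3θ+θ/5}
  set A : ℝ := β ^ (4 * θ) with hAdef
  set D : ℝ := β ^ (3 * θ + θ / 5) with hDdef
  have hA1 : 1 ≤ A := Real.one_le_rpow hβ1 (by linarith)
  have hA0 : 0 < A := by linarith only [hA1]
  have hD0 : 0 ≤ D := Real.rpow_nonneg hβ0.le _
  have hDA : D ≤ A := Real.rpow_le_rpow_of_exponent_le hβ1 (by linarith)
  have hsβ0 : 0 < Real.sqrt β := Real.sqrt_pos.2 hβ0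
  have hsβsq : Real.sqrt β ^ 2 = β := Real.sq_sqrt hβ0.le
  -- the exterior radius `r`
  set r : ℝ := Real.sqrt (2 * 278400 ^ 2 * β ^ (6 * θ + 2 * (θ / 5) - 1)) with hrdef
  have hr0 : 0 ≤ r := Real.sqrt_nonneg _
  have hϑ' : ∀ e, e ∉ boxEdges 4 (2 * ⌈β ^ θ⌉₊ + 1) → ∑ c, ϑ c e ^ 2 ≤ r ^ 2 := fun e he => by rw [hr2eq]; exact hϑ e he
  -- the numeric inequalities at this β through the dictionary
  have e1 : 4 * 10 ^ 8 * S ^ 2 * (A / Real.sqrt β) ≤ 1 := by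
    rw [hAhalf, Real.rpow_zero] at E1β; exact E1β
  have e2 : 4 * 43440 * (10 ^ 8) ^ 3 * S ^ 10 * (A ^ 3 / Real.sqrt β) ≤ 1 := by
    rw [h12θ, Real.rpow_zero] at E2β; exact E2β
  have e3 : 4 * 8 * (10 ^ 8) ^ 2 * S ^ 8 * (A ^ 2 / β) ≤ 1 := by
    rw [h8θ, Real.rpow_zero] at E3β; exact E3β
  have e4 : 32 * 43440 * (10 ^ 8) ^ 3 * S ^ 10 * (A ^ 5 / Real.sqrt β) ≤ β ^ (-θ) := by
    rw [h20θ] at E4β; exact E4β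
  have e5 : 32 * 8 * (10 ^ 8) ^ 2 * S ^ 8 * (A ^ 4 / β) ≤ β ^ (-θ) := by
    rw [h16θ] at E5β; exact E5β
  have e6 : 4 * 362 * (10 ^ 8) ^ 3 * S ^ 6 * (A ^ 3 / Real.sqrt β) ≤ β ^ (-θ) := by
    rw [h12θ] at E6β; exact E6β
  have e7 : 7 * 362 * (10 ^ 8) ^ 3 * S ^ 6 * (A / Real.sqrt β) ≤ 1 := by
    rw [hAhalf, Real.rpow_zero] at E7β; exact E7β
  have e8 : 16 ≤ β ^ θ := by rw [Real.rpow_zero, mul_one] at E8β; exact E8β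
  have e9 : 32 * β * Real.exp (-A) ≤ β ^ (-θ) := by rw [Real.rpow_one] at E9β; exact E9β
  have e10 : 12096 * 49 * (A ^ 4 * β ^ (2 * θ)) * Real.exp (-(β ^ (7 * θ))) ≤ β ^ (-θ) := by rw [h18θ] at E10β; exact E10β
  have e11 : 1440 * S ^ 4 * Real.exp (-(β ^ (7 * θ))) ≤ 1 := by rw [Real.rpow_zero] at E11β; exact E11β
  have e12 : 8908800 * D ≤ A := E12β
  -- `A² ≥ 16 β^{7θ}` since `β^θ ≥ 16`
  have hA2ge : 16 * β ^ (7 * θ) ≤ A ^ 2 := by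
    have h2 : 0 ≤ β ^ (7 * θ) := Real.rpow_nonneg hβ0.le _
    rw [hA2split]; nlinarith only [e8, h2]
  have hS2 : S ^ 2 ≤ 49 * β ^ (2 * θ) := by
    have h := boxSide_pow_le hβ1 hθ.le 2
    have hc : ((2 : ℕ) : ℝ) * θ = 2 * θ := by push_cast; ring
    have h49 : (7 : ℝ) ^ 2 = 49 := by norm_num
    rw [hc, h49] at h
    rw [hSdef]; exact h
  -- the parameters of the deterministic core
  set m : ℝ := 10 ^ 8 * S ^ 2 * (A / Real.sqrt β) with hmdef
  have hm0 : 0 ≤ m := by positivity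
  have hm4 : m ≤ 1 / 4 := by rw [hmdef]; linarith only [e1]
  have hm2 : m ^ 2 = (10 ^ 8) ^ 2 * S ^ 4 * (A ^ 2 / β) := by
    rw [hmdef, show (10 ^ 8 * S ^ 2 * (A / Real.sqrt β)) ^ 2 = (10 ^ 8) ^ 2 * S ^ 4 * (A ^ 2 / Real.sqrt β ^ 2) by ring, hsβsq]
  have hm3 : m ^ 3 = (10 ^ 8) ^ 3 * S ^ 6 * (A ^ 3 / Real.sqrt β) / β := by
    rw [hmdef, show (10 ^ 8 * S ^ 2 * (A / Real.sqrt β)) ^ 3 = (10 ^ 8) ^ 3 * S ^ 6 * (A ^ 3 / (Real.sqrt β ^ 2 * Real.sqrt β)) by ring,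
      hsβsq]
    field_simp
  set R : ℝ := A / 2 with hRdef
  set R' : ℝ := A / 4 with hR'def
  have hR0 : 0 ≤ R := by positivity
  have hR'0 : 0 ≤ R' := by positivity
  -- (hm) the link bound dominates the T4 expression
  have hm_ge : Real.sqrt 2 * ((12 * (⌈β ^ θ⌉₊ : ℝ) ^ 2 + 2 * ⌈β ^ θ⌉₊ + 1) * (Real.sqrt (β ^ (2 * (4 * θ) - 1)) + 8 * r)) ≤ m := by
    rw [hsqrtε, hmdef]
    have ha0 : 0 ≤ A / Real.sqrt β := by positivity
    have hr' : r ≤ 278400 * 2 * (A / Real.sqrt β) := by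
      refine hrle.trans ?_
      have : 278400 * Real.sqrt 2 * A / Real.sqrt β = Real.sqrt 2 * (278400 * (A / Real.sqrt β)) := by ring
      rw [this]
      nlinarith only [sqrt_two_le_two, Real.sqrt_nonneg 2, ha0]
    have hsum : A / Real.sqrt β + 8 * r ≤ 4454401 * (A / Real.sqrt β) := by linarith only [hr']
    calc Real.sqrt 2 * ((12 * (⌈β ^ θ⌉₊ : ℝ) ^ 2 + 2 * ⌈β ^ θ⌉₊ + 1) * (A / Real.sqrt β + 8 * r))
        ≤ 2 * ((12 * (⌈β ^ θ⌉₊ : ℝ) ^ 2 + 2 * ⌈β ^ θ⌉₊ + 1) * (A / Real.sqrt β + 8 * r)) :=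
          mul_le_mul_of_nonneg_right sqrt_two_le_two (by positivity)
      _ ≤ 2 * ((3 * S ^ 2) * (4454401 * (A / Real.sqrt β))) := by gcongr
      _ ≤ 10 ^ 8 * S ^ 2 * (A / Real.sqrt β) := by linarith only [mul_nonneg (sq_nonneg S) ha0]
  -- (hmE) the sandwich's link window
  have hmE : r ^ 2 + 3 * ((12 * (⌈β ^ θ⌉₊ : ℝ) ^ 2 + 2 * ⌈β ^ θ⌉₊ + 1) * ((R + R') + 4 * (Real.sqrt (2 * β) * r))) ^ 2 / (2 * β) ≤ m ^ 2 := by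
    rw [hsr, hm2, hRdef, hR'def]
    have hr2 : r ^ 2 ≤ 2 * 278400 ^ 2 * (A ^ 2 / β) := by
      rw [hr2eq, hDsq]
      gcongr
    have hinner : (12 * (⌈β ^ θ⌉₊ : ℝ) ^ 2 + 2 * ⌈β ^ θ⌉₊ + 1) * ((A / 2 + A / 4) + 4 * (556800 * D)) ≤ (3 * S ^ 2) * (2227201 * A) := by
      have h1 : (A / 2 + A / 4) + 4 * (556800 * D) ≤ 2227201 * A := by linarith only [hDA, hD0, hA0]
      exact mul_le_mul hL h1 (by positivity) (by positivity)
    have hinner0 : 0 ≤ (12 * (⌈β ^ θ⌉₊ : ℝ) ^ 2 + 2 * ⌈β ^ θ⌉₊ + 1) * ((A / 2 + A / 4) + 4 * (556800 * D)) := by positivity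
    have hsq : ((12 * (⌈β ^ θ⌉₊ : ℝ) ^ 2 + 2 * ⌈β ^ θ⌉₊ + 1) * ((A / 2 + A / 4) + 4 * (556800 * D))) ^ 2 ≤ ((3 * S ^ 2) * (2227201 * A)) ^ 2 :=
      pow_le_pow_left₀ hinner0 hinner 2
    have h3 : 3 * ((12 * (⌈β ^ θ⌉₊ : ℝ) ^ 2 + 2 * ⌈β ^ θ⌉₊ + 1) * ((A / 2 + A / 4) + 4 * (556800 * D))) ^ 2 / (2 * β) ≤
        3 * ((3 * S ^ 2) * (2227201 * A)) ^ 2 / (2 * β) := by gcongr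
    have hS4 : (1 : ℝ) ≤ S ^ 4 := one_le_pow₀ hS1
    have hAβ : 0 ≤ A ^ 2 / β := by positivity
    have hSA : 0 ≤ S ^ 4 * (A ^ 2 / β) := by positivity
    calc r ^ 2 + 3 * ((12 * (⌈β ^ θ⌉₊ : ℝ) ^ 2 + 2 * ⌈β ^ θ⌉₊ + 1) * ((A / 2 + A / 4) + 4 * (556800 * D))) ^ 2 / (2 * β)
        ≤ 2 * 278400 ^ 2 * (A ^ 2 / β) + 3 * ((3 * S ^ 2) * (2227201 * A)) ^ 2 / (2 * β) := add_le_add hr2 h3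
      _ = 2 * 278400 ^ 2 * (A ^ 2 / β) + 27 / 2 * 2227201 ^ 2 * (S ^ 4 * (A ^ 2 / β)) := by field_simp; ring
      _ ≤ 2 * 278400 ^ 2 * (S ^ 4 * (A ^ 2 / β)) + 27 / 2 * 2227201 ^ 2 * (S ^ 4 * (A ^ 2 / β)) := by nlinarith only [hS4, hAβ]
      _ ≤ (10 ^ 8) ^ 2 * S ^ 4 * (A ^ 2 / β) := by linarith only [hSA]
  -- (hwinE) the sandwich's cost window
  have hwinE : 3 * (R + R') ^ 2 / (2 * β) + 362 * m ^ 3 < β ^ (2 * (4 * θ) - 1) := by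
    rw [hεeq, hm3, hRdef, hR'def]
    have hAβ : 0 < A ^ 2 / β := by positivity
    have h1 : 362 * ((10 ^ 8) ^ 3 * S ^ 6 * (A ^ 3 / Real.sqrt β) / β) ≤ 1 / 7 * (A ^ 2 / β) := by
      have key : 362 * ((10 ^ 8) ^ 3 * S ^ 6 * (A ^ 3 / Real.sqrt β) / β) =
          1 / 7 * (7 * 362 * (10 ^ 8) ^ 3 * S ^ 6 * (A / Real.sqrt β)) * (A ^ 2 / β) := by
        field_simp
      rw [key]
      nlinarith only [e7, hAβ.le]
    have h2 : 3 * (A / 2 + A / 4) ^ 2 / (2 * β) = 27 / 32 * (A ^ 2 / β) := by field_simp; ring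
    rw [h2]
    linarith only [h1, hAβ]
  -- (hp2) the Gaussian bad mass bound is ≤ 1/2
  have hexpR : Real.exp (-R ^ 2 / 2) ≤ Real.exp (-(2 * β ^ (7 * θ))) := by
    rw [Real.exp_le_exp, hRdef]
    have h3 : -(A / 2) ^ 2 / 2 = -(A ^ 2 / 8) := by ring
    rw [h3]; linarith only [hA2ge]
  have hexp1 : Real.exp (-(2 * β ^ (7 * θ))) ≤ Real.exp (-(β ^ (7 * θ))) := by
    rw [Real.exp_le_exp]; have : 0 ≤ β ^ (7 * θ) := Real.rpow_nonneg hβ0.le _; linarith only [this]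
  have hp2 : 720 * (2 * (⌈β ^ θ⌉₊ : ℝ) + 1) ^ 4 * Real.exp (-R ^ 2 / 2) ≤ 1 / 2 := by
    have : 720 * (2 * (⌈β ^ θ⌉₊ : ℝ) + 1) ^ 4 * Real.exp (-R ^ 2 / 2) ≤ 720 * S ^ 4 * Real.exp (-(β ^ (7 * θ))) :=
      mul_le_mul (by gcongr) (hexpR.trans hexp1) (Real.exp_pos _).le (by positivity)
    linarith only [this, e11]
  -- (hF) the background circulations are ≤ R' = A/4
  have hF : ∀ (c : Fin 3) (p : ZdPlaquette 4), |sCirc (glue (pin := fun e => e ∉ dirFreeEdges ⌈β ^ θ⌉₊) dirCorner (2 * ⌈β ^ θ⌉₊ + 3) (sdat β ϑ c)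
      (mean (fun e => e ∉ dirFreeEdges ⌈β ^ θ⌉₊) dirCorner (2 * ⌈β ^ θ⌉₊ + 3) (sdat β ϑ c))) (p.1, p.2.1.1, p.2.1.2)| ≤ R' := by
    intro c p
    by_cases hp : p ∈ plaquettesTouching (boxEdges 4 (2 * ⌈β ^ θ⌉₊ + 1))
    · have h := hshiftβ p hp c
      rw [dirBackground_sdat_eq, abs_mul, abs_of_nonneg (Real.sqrt_nonneg _), hR'def]
      exact h
    · have h := abs_dirBackground_sdat_le_of_not_touching (β := β) hr0 hϑ' hforest c hp
      rw [hsr] at h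
      rw [hR'def]
      linarith only [h, e12]
  -- (hbad) the YM bad mass, transported from ω to W
  have hbad : (boxKernel β ⌈β ^ θ⌉₊ W).real (coldGoodSet β (4 * θ) ⌈β ^ θ⌉₊)ᶜ ≤ Real.exp (-A) := by
    rw [coldGoodSet, compl_compl] at hrareβ ⊢
    rw [hWdef, ← measureReal_largeField_boxKernel_eq_of_gauge_trunc β (β ^ (2 * (4 * θ) - 1)) ⌈β ^ θ⌉₊ ω g]
    exact hrareβ
  have hpY1 : Real.exp (-A) < 1 := by rw [Real.exp_lt_one_iff]; linarith only [hA0]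
  -- the plaquette touches the box
  have hxt := near_centre_mem_plaquettesTouching hH hx
  -- the deterministic instantiated core at `W`
  have hcore := abs_kernelMean_sub_le_of_trunk (ε := 4 * θ) hβ0 hH hr0 hR0 hR'0 hW hϑ' hforest hF hbad hpY1 hm_ge hm4 hmE hwinE hp2
    (show (1 : Fin 4) < 2 by decide) hxt
  -- transport of the mean from `ω` to `W`
  have hXm : Measurable (plaqCostAt (G := Matrix.specialUnitaryGroup (Fin 2) ℂ) (fundamentalRep (Fin 2)) x 1 2) := measurable_plaqCostAt x 1 2
  have hmean : ∫ U, plaqCostAt (fundamentalRep (Fin 2)) x 1 2 U ∂(boxKernel β ⌈β ^ θ⌉₊ ω) =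
      ∫ U, plaqCostAt (fundamentalRep (Fin 2)) x 1 2 U ∂(boxKernel β ⌈β ^ θ⌉₊ W) := by
    rw [integral_plaqCostAt_boxKernel_eq_trunc_gauge_of_near_centre β hH ω g hx (show (1 : Fin 4) ≠ 2 by decide), hWdef,
      integral_boxKernel_forestFix_eq β ⌈β ^ θ⌉₊ _ hXm (isZdGaugeInvariant_plaqCostAt (fundamentalRep (Fin 2)) x 1 2)]
  -- the constant term: ½Σ(√(2β)F̄)² = βΣF̄²
  have hconst : 1 / 2 * ∑ c, (Real.sqrt (2 * β) * sCirc (glue (pin := fun e => e ∉ dirFreeEdges ⌈β ^ θ⌉₊) dirCorner (2 * ⌈β ^ θ⌉₊ + 3) (ϑ c)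
            (mean (fun e => e ∉ dirFreeEdges ⌈β ^ θ⌉₊) dirCorner (2 * ⌈β ^ θ⌉₊ + 3) (ϑ c))) (x, 1, 2)) ^ 2 = β * ∑ c, (sCirc (glue (pin := fun e => e ∉ dirFreeEdges ⌈β ^ θ⌉₊) dirCorner (2 * ⌈β ^ θ⌉₊ + 3) (ϑ c)
            (mean (fun e => e ∉ dirFreeEdges ⌈β ^ θ⌉₊) dirCorner (2 * ⌈β ^ θ⌉₊ + 3) (ϑ c))) (x, 1, 2)) ^ 2 :=
    half_sum_sq_sdat_shift_eq hβ0.le _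
  rw [hmean]
  have hshape : β * (∫ U, plaqCostAt (fundamentalRep (Fin 2)) x 1 2 U ∂(boxKernel β ⌈β ^ θ⌉₊ W)) -
      3 / 2 * boxDirProjKernel ⌈β ^ θ⌉₊ (x, 1, 2) (x, 1, 2) - β * ∑ c, (sCirc (glue (pin := fun e => e ∉ dirFreeEdges ⌈β ^ θ⌉₊) dirCorner (2 * ⌈β ^ θ⌉₊ + 3) (ϑ c)
            (mean (fun e => e ∉ dirFreeEdges ⌈β ^ θ⌉₊) dirCorner (2 * ⌈β ^ θ⌉₊ + 3) (ϑ c))) (x, 1, 2)) ^ 2 =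
      β * (∫ U, plaqCostAt (fundamentalRep (Fin 2)) x 1 2 U ∂(boxKernel β ⌈β ^ θ⌉₊ W)) -
        (3 / 2 * boxDirProjKernel ⌈β ^ θ⌉₊ (x, 1, 2) (x, 1, 2) + 1 / 2 * ∑ c, (Real.sqrt (2 * β) * sCirc (glue (pin := fun e => e ∉ dirFreeEdges ⌈β ^ θ⌉₊) dirCorner (2 * ⌈β ^ θ⌉₊ + 3) (ϑ c)
            (mean (fun e => e ∉ dirFreeEdges ⌈β ^ θ⌉₊) dirCorner (2 * ⌈β ^ θ⌉₊ + 3) (ϑ c))) (x, 1, 2)) ^ 2) := by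
    rw [hconst]; ring
  rw [hshape]
  refine hcore.trans ?_
  -- bookkeeping of the four error terms
  -- (i) background at the centre plaquette, variance bound
  have hFc : ∀ c, |Real.sqrt (2 * β) * sCirc (glue (pin := fun e => e ∉ dirFreeEdges ⌈β ^ θ⌉₊) dirCorner (2 * ⌈β ^ θ⌉₊ + 3) (ϑ c)
            (mean (fun e => e ∉ dirFreeEdges ⌈β ^ θ⌉₊) dirCorner (2 * ⌈β ^ θ⌉₊ + 3) (ϑ c))) (x, 1, 2)| ≤ A / 4 := by
    intro c
    have h := hshiftβ _ hxt c
    rw [abs_mul, abs_of_nonneg (Real.sqrt_nonneg _)]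
    exact h
  have hC1 : boxDirProjKernel ⌈β ^ θ⌉₊ (x, 1, 2) (x, 1, 2) ≤ 1 := by
    have hq := unshift_mem_plaquettesIn hxt
    have h := boxDirProjKernel_le_one_of_mem (H := ⌈β ^ θ⌉₊) hq hq
    have hs : Plaq.shift dirCorner ((x - dirCorner, (1 : Fin 4), (2 : Fin 4)) : Plaq 4) = (x, 1, 2) := by simp [Plaq.shift]
    simpa only [hs] using h
  have hC0 : 0 ≤ boxDirProjKernel ⌈β ^ θ⌉₊ (x, 1, 2) (x, 1, 2) := by
    have hpq : boxDirProjKernel ⌈β ^ θ⌉₊ (x, 1, 2) (x, 1, 2) =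
        ∫ s, dirCirc ⌈β ^ θ⌉₊ (x, 1, 2) s * dirCirc ⌈β ^ θ⌉₊ (x, 1, 2) s ∂(boxDirichlet ⌈β ^ θ⌉₊) := (integral_dirCirc_mul _ _).symm
    rw [hpq]
    exact integral_nonneg fun s => mul_self_nonneg _
  have hQ : ∑ c, ((Real.sqrt (2 * β) * sCirc (glue (pin := fun e => e ∉ dirFreeEdges ⌈β ^ θ⌉₊) dirCorner (2 * ⌈β ^ θ⌉₊ + 3) (ϑ c)
            (mean (fun e => e ∉ dirFreeEdges ⌈β ^ θ⌉₊) dirCorner (2 * ⌈β ^ θ⌉₊ + 3) (ϑ c))) (x, 1, 2)) ^ 4 + 3 * boxDirProjKernel ⌈β ^ θ⌉₊ (x, 1, 2) (x, 1, 2) ^ 2) ≤ 3 * ((A / 4) ^ 4 + 3) := by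
    have hterm : ∀ c, (Real.sqrt (2 * β) * sCirc (glue (pin := fun e => e ∉ dirFreeEdges ⌈β ^ θ⌉₊) dirCorner (2 * ⌈β ^ θ⌉₊ + 3) (ϑ c)
            (mean (fun e => e ∉ dirFreeEdges ⌈β ^ θ⌉₊) dirCorner (2 * ⌈β ^ θ⌉₊ + 3) (ϑ c))) (x, 1, 2)) ^ 4 + 3 * boxDirProjKernel ⌈β ^ θ⌉₊ (x, 1, 2) (x, 1, 2) ^ 2 ≤ (A / 4) ^ 4 + 3 := by
      intro c
      have h1 : (Real.sqrt (2 * β) * sCirc (glue (pin := fun e => e ∉ dirFreeEdges ⌈β ^ θ⌉₊) dirCorner (2 * ⌈β ^ θ⌉₊ + 3) (ϑ c)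
            (mean (fun e => e ∉ dirFreeEdges ⌈β ^ θ⌉₊) dirCorner (2 * ⌈β ^ θ⌉₊ + 3) (ϑ c))) (x, 1, 2)) ^ 4 ≤ (A / 4) ^ 4 := by
        have := pow_le_pow_left₀ (abs_nonneg _) (hFc c) 4
        rwa [Even.pow_abs (⟨2, rfl⟩ : Even 4)] at this
      have h2 : boxDirProjKernel ⌈β ^ θ⌉₊ (x, 1, 2) (x, 1, 2) ^ 2 ≤ 1 := by nlinarith only [hC0, hC1]
      exact add_le_add h1 (by linarith only [h2])
    calc ∑ c, ((Real.sqrt (2 * β) * sCirc (glue (pin := fun e => e ∉ dirFreeEdges ⌈β ^ θ⌉₊) dirCorner (2 * ⌈β ^ θ⌉₊ + 3) (ϑ c)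
            (mean (fun e => e ∉ dirFreeEdges ⌈β ^ θ⌉₊) dirCorner (2 * ⌈β ^ θ⌉₊ + 3) (ϑ c))) (x, 1, 2)) ^ 4 + 3 * boxDirProjKernel ⌈β ^ θ⌉₊ (x, 1, 2) (x, 1, 2) ^ 2) ≤ ∑ _c : Fin 3, ((A / 4) ^ 4 + 3) :=
          Finset.sum_le_sum fun c _ => hterm c
      _ = 3 * ((A / 4) ^ 4 + 3) := by rw [Finset.sum_const, Finset.card_univ, Fintype.card_fin, nsmul_eq_mul]; ring
  -- name the Gaussian moment sum (keeps the arithmetic tactics away from `glue`)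
  generalize hQdef : (∑ c, ((Real.sqrt (2 * β) * sCirc (glue (pin := fun e => e ∉ dirFreeEdges ⌈β ^ θ⌉₊) dirCorner (2 * ⌈β ^ θ⌉₊ + 3) (ϑ c)
            (mean (fun e => e ∉ dirFreeEdges ⌈β ^ θ⌉₊) dirCorner (2 * ⌈β ^ θ⌉₊ + 3) (ϑ c))) (x, 1, 2)) ^ 4 + 3 * boxDirProjKernel ⌈β ^ θ⌉₊ (x, 1, 2) (x, 1, 2) ^ 2)) = Q at hQ ⊢
  -- (ii) cardinalities
  have hP : (#(plaquettesTouching (boxEdges 4 (2 * ⌈β ^ θ⌉₊ + 1))) : ℝ) ≤ 120 * S ^ 4 := by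
    have h := card_plaquettesTouching_boxEdges_le (2 * ⌈β ^ θ⌉₊ + 1)
    have h' : ((#(plaquettesTouching (boxEdges 4 (2 * ⌈β ^ θ⌉₊ + 1))) : ℕ) : ℝ) ≤ ((120 * (2 * ⌈β ^ θ⌉₊ + 1) ^ 4 : ℕ) : ℝ) := by exact_mod_cast h
    push_cast at h'
    linarith only [h', h4S]
  have hN : (Fintype.card (ColdFreeIdx ⌈β ^ θ⌉₊) : ℝ) ≤ 4 * S ^ 4 := by
    have h1 : Fintype.card (ColdFreeIdx ⌈β ^ θ⌉₊) ≤ Fintype.card ↥(boxEdges 4 (2 * ⌈β ^ θ⌉₊ + 1)) := Fintype.card_subtype_le _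
    rw [Fintype.card_coe] at h1
    have h2 := card_boxEdges_four_le (2 * ⌈β ^ θ⌉₊ + 1)
    have h' : ((Fintype.card (ColdFreeIdx ⌈β ^ θ⌉₊) : ℕ) : ℝ) ≤ ((4 * (2 * ⌈β ^ θ⌉₊ + 1) ^ 4 : ℕ) : ℝ) := by exact_mod_cast h1.trans h2
    push_cast at h'
    linarith only [h', h4S]
  -- (iii) the tilt size
  have hw_le : (#(plaquettesTouching (boxEdges 4 (2 * ⌈β ^ θ⌉₊ + 1))) : ℝ) * (362 * β * m ^ 3) + 2 * (Fintype.card (ColdFreeIdx ⌈β ^ θ⌉₊) : ℝ) * m ^ 2 ≤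
      43440 * (10 ^ 8) ^ 3 * S ^ 10 * (A ^ 3 / Real.sqrt β) + 8 * (10 ^ 8) ^ 2 * S ^ 8 * (A ^ 2 / β) := by
    rw [hm2, hm3]
    have h1 : (#(plaquettesTouching (boxEdges 4 (2 * ⌈β ^ θ⌉₊ + 1))) : ℝ) * (362 * β * ((10 ^ 8) ^ 3 * S ^ 6 * (A ^ 3 / Real.sqrt β) / β)) ≤
        120 * S ^ 4 * (362 * β * ((10 ^ 8) ^ 3 * S ^ 6 * (A ^ 3 / Real.sqrt β) / β)) :=
      mul_le_mul_of_nonneg_right hP (by positivity)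
    have h2 : 2 * (Fintype.card (ColdFreeIdx ⌈β ^ θ⌉₊) : ℝ) * ((10 ^ 8) ^ 2 * S ^ 4 * (A ^ 2 / β)) ≤
        2 * (4 * S ^ 4) * ((10 ^ 8) ^ 2 * S ^ 4 * (A ^ 2 / β)) := by gcongr
    have e : 120 * S ^ 4 * (362 * β * ((10 ^ 8) ^ 3 * S ^ 6 * (A ^ 3 / Real.sqrt β) / β)) =
        43440 * (10 ^ 8) ^ 3 * S ^ 10 * (A ^ 3 / Real.sqrt β) := by
      field_simp; ring
    have e' : 2 * (4 * S ^ 4) * ((10 ^ 8) ^ 2 * S ^ 4 * (A ^ 2 / β)) = 8 * (10 ^ 8) ^ 2 * S ^ 8 * (A ^ 2 / β) := by ring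
    linarith only [h1, h2, e, e']
  have hw0 : 0 ≤ (#(plaquettesTouching (boxEdges 4 (2 * ⌈β ^ θ⌉₊ + 1))) : ℝ) * (362 * β * m ^ 3) + 2 * (Fintype.card (ColdFreeIdx ⌈β ^ θ⌉₊) : ℝ) * m ^ 2 :=
    add_nonneg (mul_nonneg (Nat.cast_nonneg _) (by positivity)) (mul_nonneg (mul_nonneg (by norm_num) (Nat.cast_nonneg _)) (sq_nonneg _))
  have hw_half : (#(plaquettesTouching (boxEdges 4 (2 * ⌈β ^ θ⌉₊ + 1))) : ℝ) * (362 * β * m ^ 3) + 2 * (Fintype.card (ColdFreeIdx ⌈β ^ θ⌉₊) : ℝ) * m ^ 2 ≤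
      1 / 2 := by linarith only [hw_le, e2, e3]
  have hAw : 16 * A ^ 2 * ((#(plaquettesTouching (boxEdges 4 (2 * ⌈β ^ θ⌉₊ + 1))) : ℝ) * (362 * β * m ^ 3) +
      2 * (Fintype.card (ColdFreeIdx ⌈β ^ θ⌉₊) : ℝ) * m ^ 2) ≤ β ^ (-θ) := by
    have h1 : 16 * A ^ 2 * (43440 * (10 ^ 8) ^ 3 * S ^ 10 * (A ^ 3 / Real.sqrt β)) =
        1 / 2 * (32 * 43440 * (10 ^ 8) ^ 3 * S ^ 10 * (A ^ 5 / Real.sqrt β)) := by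
      field_simp; ring
    have h2 : 16 * A ^ 2 * (8 * (10 ^ 8) ^ 2 * S ^ 8 * (A ^ 2 / β)) = 1 / 2 * (32 * 8 * (10 ^ 8) ^ 2 * S ^ 8 * (A ^ 4 / β)) := by
      field_simp; ring
    have hA2pos : 0 ≤ 16 * A ^ 2 := by positivity
    calc 16 * A ^ 2 * ((#(plaquettesTouching (boxEdges 4 (2 * ⌈β ^ θ⌉₊ + 1))) : ℝ) * (362 * β * m ^ 3) +
          2 * (Fintype.card (ColdFreeIdx ⌈β ^ θ⌉₊) : ℝ) * m ^ 2)
        ≤ 16 * A ^ 2 * (43440 * (10 ^ 8) ^ 3 * S ^ 10 * (A ^ 3 / Real.sqrt β) + 8 * (10 ^ 8) ^ 2 * S ^ 8 * (A ^ 2 / β)) :=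
          mul_le_mul_of_nonneg_left hw_le hA2pos
      _ = 1 / 2 * (32 * 43440 * (10 ^ 8) ^ 3 * S ^ 10 * (A ^ 5 / Real.sqrt β)) + 1 / 2 * (32 * 8 * (10 ^ 8) ^ 2 * S ^ 8 * (A ^ 4 / β)) := by
          rw [mul_add, h1, h2]
      _ ≤ 1 / 2 * β ^ (-θ) + 1 / 2 * β ^ (-θ) := by linarith only [e4, e5]
      _ = β ^ (-θ) := by ring
  -- term 1: YM conditioning
  have t1 : 2 * (4 * β) * Real.exp (-A) ≤ β ^ (-θ) / 4 := by linarith only [e9]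
  -- term 2: the tilt
  have t2 : β ^ (2 * (4 * θ)) * (Real.exp (2 * ((#(plaquettesTouching (boxEdges 4 (2 * ⌈β ^ θ⌉₊ + 1))) : ℝ) * (362 * β * m ^ 3) +
      2 * (Fintype.card (ColdFreeIdx ⌈β ^ θ⌉₊) : ℝ) * m ^ 2)) - 1) ≤ β ^ (-θ) / 4 := by
    rw [hA2]
    have habs : |2 * ((#(plaquettesTouching (boxEdges 4 (2 * ⌈β ^ θ⌉₊ + 1))) : ℝ) * (362 * β * m ^ 3) +
      2 * (Fintype.card (ColdFreeIdx ⌈β ^ θ⌉₊) : ℝ) * m ^ 2)| ≤ 1 := by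
      rw [abs_of_nonneg (by linarith only [hw0])]; linarith only [hw_half]
    have h := Real.abs_exp_sub_one_le habs
    rw [abs_of_nonneg (by linarith only [hw0] : (0 : ℝ) ≤ 2 * ((#(plaquettesTouching (boxEdges 4 (2 * ⌈β ^ θ⌉₊ + 1))) : ℝ) * (362 * β * m ^ 3) +
      2 * (Fintype.card (ColdFreeIdx ⌈β ^ θ⌉₊) : ℝ) * m ^ 2))] at h
    have h' : Real.exp (2 * ((#(plaquettesTouching (boxEdges 4 (2 * ⌈β ^ θ⌉₊ + 1))) : ℝ) * (362 * β * m ^ 3) +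
      2 * (Fintype.card (ColdFreeIdx ⌈β ^ θ⌉₊) : ℝ) * m ^ 2)) - 1 ≤ 4 * ((#(plaquettesTouching (boxEdges 4 (2 * ⌈β ^ θ⌉₊ + 1))) : ℝ) * (362 * β * m ^ 3) +
      2 * (Fintype.card (ColdFreeIdx ⌈β ^ θ⌉₊) : ℝ) * m ^ 2) := by
      linarith only [h, le_abs_self (Real.exp (2 * ((#(plaquettesTouching (boxEdges 4 (2 * ⌈β ^ θ⌉₊ + 1))) : ℝ) * (362 * β * m ^ 3) +
      2 * (Fintype.card (ColdFreeIdx ⌈β ^ θ⌉₊) : ℝ) * m ^ 2)) - 1)]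
    calc A ^ 2 * (Real.exp (2 * ((#(plaquettesTouching (boxEdges 4 (2 * ⌈β ^ θ⌉₊ + 1))) : ℝ) * (362 * β * m ^ 3) +
      2 * (Fintype.card (ColdFreeIdx ⌈β ^ θ⌉₊) : ℝ) * m ^ 2)) - 1) ≤ A ^ 2 * (4 * ((#(plaquettesTouching (boxEdges 4 (2 * ⌈β ^ θ⌉₊ + 1))) : ℝ) * (362 * β * m ^ 3) +
      2 * (Fintype.card (ColdFreeIdx ⌈β ^ θ⌉₊) : ℝ) * m ^ 2)) :=
          mul_le_mul_of_nonneg_left h' (by positivity)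
      _ ≤ β ^ (-θ) / 4 := by linarith only [hAw]
  -- term 3: linearisation
  have t3 : 362 * β * m ^ 3 ≤ β ^ (-θ) / 4 := by
    rw [hm3]
    have e : 362 * β * ((10 ^ 8) ^ 3 * S ^ 6 * (A ^ 3 / Real.sqrt β) / β) = 362 * ((10 ^ 8) ^ 3 * S ^ 6 * (A ^ 3 / Real.sqrt β)) := by
      rw [mul_assoc, ← mul_div_assoc, mul_div_cancel_left₀ _ hβ0.ne']
    rw [e]; linarith only [e6]
  -- term 4: the Gaussian moments × √p
  have t4 : 2 * (1 + 6 * Q) * Real.sqrt (720 * (2 * (⌈β ^ θ⌉₊ : ℝ) + 1) ^ 4 * Real.exp (-R ^ 2 / 2)) ≤ β ^ (-θ) / 4 := by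
    have hq : 1 + 6 * Q ≤ 56 * A ^ 4 := by
      have hA4' : 1 ≤ A ^ 4 := one_le_pow₀ hA1
      linarith only [hQ, hA4']
    have hsq : Real.sqrt (720 * (2 * (⌈β ^ θ⌉₊ : ℝ) + 1) ^ 4 * Real.exp (-R ^ 2 / 2)) ≤ 27 * S ^ 2 * Real.exp (-(β ^ (7 * θ))) := by
      have h1 : 720 * (2 * (⌈β ^ θ⌉₊ : ℝ) + 1) ^ 4 * Real.exp (-R ^ 2 / 2) ≤ (27 * S ^ 2 * Real.exp (-(β ^ (7 * θ)))) ^ 2 := by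
        have he : Real.exp (-(β ^ (7 * θ))) ^ 2 = Real.exp (-(2 * β ^ (7 * θ))) := by
          rw [← Real.exp_nat_mul]; congr 1; push_cast; ring
        rw [mul_pow, mul_pow, he, show (S ^ 2) ^ 2 = S ^ 4 by ring]
        calc 720 * (2 * (⌈β ^ θ⌉₊ : ℝ) + 1) ^ 4 * Real.exp (-R ^ 2 / 2) ≤ 720 * S ^ 4 * Real.exp (-(2 * β ^ (7 * θ))) :=
              mul_le_mul (by gcongr) hexpR (Real.exp_pos _).le (by positivity)
          _ ≤ 27 ^ 2 * S ^ 4 * Real.exp (-(2 * β ^ (7 * θ))) := by gcongr; norm_num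
      calc Real.sqrt (720 * (2 * (⌈β ^ θ⌉₊ : ℝ) + 1) ^ 4 * Real.exp (-R ^ 2 / 2)) ≤ Real.sqrt ((27 * S ^ 2 * Real.exp (-(β ^ (7 * θ)))) ^ 2) :=
            Real.sqrt_le_sqrt h1
        _ = 27 * S ^ 2 * Real.exp (-(β ^ (7 * θ))) := Real.sqrt_sq (by positivity)
    have hq0 : 0 ≤ 1 + 6 * Q := by
      have : 0 ≤ Q := by
        rw [← hQdef]
        exact Finset.sum_nonneg fun c _ => add_nonneg (Even.pow_nonneg (⟨2, rfl⟩ : Even 4) _) (mul_nonneg (by norm_num) (sq_nonneg _))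
      linarith only [this]
    calc 2 * (1 + 6 * Q) * Real.sqrt (720 * (2 * (⌈β ^ θ⌉₊ : ℝ) + 1) ^ 4 * Real.exp (-R ^ 2 / 2))
        ≤ 2 * (56 * A ^ 4) * (27 * S ^ 2 * Real.exp (-(β ^ (7 * θ)))) :=
          mul_le_mul (mul_le_mul_of_nonneg_left hq (by norm_num)) hsq (Real.sqrt_nonneg _) (by positivity)
      _ = 3024 * (A ^ 4 * S ^ 2) * Real.exp (-(β ^ (7 * θ))) := by ring
      _ ≤ 3024 * (A ^ 4 * (49 * β ^ (2 * θ))) * Real.exp (-(β ^ (7 * θ))) := by gcongr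
      _ = 1 / 4 * (12096 * 49 * (A ^ 4 * β ^ (2 * θ)) * Real.exp (-(β ^ (7 * θ)))) := by ring
      _ ≤ β ^ (-θ) / 4 := by linarith only [e10]
  linarith only [t1, t2, t3, t4]

end Summit.QuantumFields.YangMills.Theorems.WeakCouplingRates

end
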